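import Literature.RepresentationTheory.MoeglinVignerasWaldspurger1987.RankOneTorusTraceHolds
import HarnessLib

/-!
# The Schur scalars of the rank `1 × 1` oscillator representation on Weil's big cell form a cocycle:
# `λ(z) λ(z') · κ(T) = λ(z z')`, `κ(T) = g_ψ(-T/2) ‖T‖^{1/2}`

Topic `RepresentationTheory/MoeglinVignerasWaldspurger1987`; namespace
`Literature.RepresentationTheory.MoeglinVignerasWaldspurger1987`.  THEOREMS ONLY (no definition, no named fact, no
`sorry`).  For the section `s₁ : U(J₁)(F_v) →* S̃p(𝕎_v)` over `ι_v` and `z, z', zz'` in Weil's big cell (scalars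
`ζ = a + b δ`, `ζ' = a' + b' δ`, `b, b', ab' + a'b ≠ 0`), the scalars `λ` with `ω_{s₁}(u) = λ(u) · r(e ι_v(u) e⁻¹)`
(`r = bigCellOp`, ★ `rankOne_exists_scalar_bigCellWord`) satisfy

  `λ(z) λ(z') · g_{ψ_v}(-T/2) · ‖T‖_v^{1/2} = λ(zz')`,  `T = β' (β⁻¹ a + a' β'⁻¹) β'`, `β = d b τ⁻¹`, `β' = d b' τ⁻¹`

(**`rankOne_scalar_cocycle`**) — `s₁` is a homomorphism, `e ι_v(·) e⁻¹` is one, and Weil's multiplication formula on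
the big cell ★ `HeisenbergGroup.bigCellOp_mul_bigCellOp` (`r(g₁) r(g₂) = κ(T) r(g₁g₂)`, `T = ᵗB₂ (δ₁ + γ₂) B₂`) with the
rank-one cells of ★ `rankOne_cells`; `κ(T) = weilKappa` is read as Weil's ONE-VARIABLE stable Gauss integral
(`weilKappa_smulOfNeZero`, via ★ `weilGaussQF_eq_of_eq_weightedSumSquares`).  Cell `hodgecm-mathlib`, h413 road,
SOCKETS-H413 §3 S6 «G2a» (file X1 of the character route: together with ★ `rankOne_torusTrace_eq_explicit` and the
scaling law ★/`WeilGaussScalarMul` it yields the cross-line sign of the two oscillator characters).  HC_CM is NOT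
advanced by this file alone; it is proved only modulo the 7 printed citations until rung 0 of the ladder closes.

## References
* [Weil1964] A. Weil, Acta Math. 111 (1964): n° 15 Thm. 3 p. 163 (`r(s) r(s') = γ(f₀) r(s'')`), Chap. II n° 27 p. 175.
* [Rangarao1993] R. Ranga Rao, Pacific J. Math. 157 (1993), Thm. 4.1 (4) p. 358.
* [MoeglinVignerasWaldspurger1987] C. Mœglin, M.-F. Vignéras, J.-L. Waldspurger, LNM 1291 (1987), Chap. 2 II.1 (A).
-/

set_option autoImplicit false

noncomputable section

open NumberField IsDedekindDomain Matrix MeasureTheory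
open scoped Matrix MatrixGroups NNReal Topology
open Literature.RepresentationTheory Literature.RepresentationTheory.HeisenbergGroup
open Literature.NumberTheory.GelbartRogawski1991.UnitaryDualPair.LocalSplitting
open Literature.NumberTheory.Automorphic Literature.NumberTheory.Automorphic.UnitaryGroup
open Literature.NumberTheory.Automorphic.Liu2021
open Literature.NumberTheory.GaloisRepresentations.IsNonarchimedeanLocalField
open Literature.NumberTheory.Weil1964

namespace Literature.RepresentationTheory.MoeglinVignerasWaldspurger1987

/-! ## §1 Weil's constant of a homothety of `F^1` is a one-variable Gauss integral -/

section Kappa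

variable {K : Type*} [Field K] [ValuativeRel K] [TopologicalSpace K] [IsNonarchimedeanLocalField K]
  [Invertible (2 : K)] {ψ : AddChar K Circle} [MeasurableSpace K] [BorelSpace K] (μ : Measure K) [μ.IsAddHaarMeasure]

/-- **`κ(T·1) = g_ψ(-T/2) · ‖T‖^{1/2}` on `F^1`**: Weil's constant `κ(S) = g(-q_S) |det S|^{1/2}` of the homothety
`S = T·1` of `F^1` is the one-variable stable Gauss integral of `x ↦ -½ T x²` times `‖T‖^{1/2}`.
[cite: Weil1964, Chap. II n° 27, p. 175] -/
theorem weilKappa_smulOfNeZero (hψ : ψ.IsContinuousNontrivial) {T : K} (hT : T ≠ 0) :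
    weilKappa μ (ψ := ψ) (LinearEquiv.smulOfNeZero K (Fin 1 → K) T hT) =
      weilGauss ψ μ (-(⅟(2 : K) * T)) * (Real.sqrt (normAbs K T) : ℂ) := by
  have htwo : (2 : K) ≠ 0 := Invertible.ne_zero 2
  have hc : ∀ _i : Fin 1, -(⅟(2 : K) * T) ≠ 0 := fun _ => neg_ne_zero.2 (mul_ne_zero (Invertible.ne_zero _) hT)
  have hQ : ∀ x : Fin 1 → K,
      negHalfQF ((LinearEquiv.smulOfNeZero K (Fin 1 → K) T hT : (Fin 1 → K) ≃ₗ[K] (Fin 1 → K)) :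
        (Fin 1 → K) →ₗ[K] (Fin 1 → K)) x =
        QuadraticMap.weightedSumSquares K (fun _ : Fin 1 => -(⅟(2 : K) * T)) ((LinearEquiv.refl K (Fin 1 → K)) x) := by
    intro x
    rw [negHalfQF_apply, halfForm_apply, QuadraticMap.weightedSumSquares_apply, Fin.sum_univ_one, LinearEquiv.refl_apply,
      LinearEquiv.coe_coe, LinearEquiv.smulOfNeZero_apply]
    simp only [dotProduct, Fin.sum_univ_one, Pi.smul_apply, smul_eq_mul]
    ring
  have hdet : LinearMap.det ((LinearEquiv.smulOfNeZero K (Fin 1 → K) T hT : (Fin 1 → K) ≃ₗ[K] (Fin 1 → K)) :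
      (Fin 1 → K) →ₗ[K] (Fin 1 → K)) = T := by
    have e : ((LinearEquiv.smulOfNeZero K (Fin 1 → K) T hT : (Fin 1 → K) ≃ₗ[K] (Fin 1 → K)) :
        (Fin 1 → K) →ₗ[K] (Fin 1 → K)) = T • LinearMap.id := by
      apply LinearMap.ext; intro x; rw [LinearEquiv.coe_coe, LinearEquiv.smulOfNeZero_apply, LinearMap.smul_apply,
        LinearMap.id_apply]
    rw [e, LinearMap.det_smul, LinearMap.det_id, mul_one, Module.finrank_fintype_fun_eq_card, Fintype.card_fin, pow_one]
  rw [weilKappa, weilGaussQF_eq_of_eq_weightedSumSquares μ hψ htwo hc hQ, modSqrt, hdet, Fin.prod_univ_one]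
  simp only [LinearEquiv.refl_toLinearMap, LinearMap.det_id, map_one, inv_one, NNReal.coe_one, one_smul]

end Kappa

/-! ## §2 The cocycle of the Schur scalars -/

section Cocycle

variable (F : Type) [Field F] [NumberField F] (E : Type) [Field E] [NumberField E] [Algebra F E]
  [Algebra.IsQuadraticExtension F E] (c : E ≃ₐ[F] E) (δ : E) (hcδ : c δ = -δ) (hδ : δ ≠ 0) (d : F)
  (hd : δ * δ = algebraMap F E d) (t : Matrix (Fin 1) (Fin 1) F) (ht : t.IsSymm) (htd : IsUnit t.det)
  (J₁ : Matrix (Fin 1) (Fin 1) E) (hJ₁ : J₁ = t.map (algebraMap F E)) (v : HeightOneSpectrum (𝓞 F))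
  (s₁ : localPi E c 1 J₁ v →* LocalMp F 1 t v)

set_option maxHeartbeats 1600000 in -- MEASURED: three big-cell elements with their cells in one context time out at 800 k
/-- **THE SCHUR SCALARS ARE A COCYCLE ON THE BIG CELL.**  For `z, z' ∈ U(J₁)(F_v)` with scalars `ζ = a + b δ`,
`ζ' = a' + b' δ` (`β = d b τ⁻¹ ≠ 0`, `β' = d b' τ⁻¹ ≠ 0`) and `zz'` also in the big cell
(`β'' = d (a b' + b a') τ⁻¹ ≠ 0`), and `λ, λ', λ''` THE scalars with `ω_{s₁}(z) = λ · r(e ι(z) e⁻¹)`,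
`ω_{s₁}(z') = λ' · r(e ι(z') e⁻¹)`, `ω_{s₁}(zz') = λ'' · r(e ι(zz') e⁻¹)`:
`λ λ' · g_{ψ_v}(-T/2) ‖T‖_v^{1/2} = λ''` with `T = β' ((β⁻¹ a + a' β'⁻¹) β')` (Weil's `ᵗB₂ (δ₁ + γ₂) B₂` read on the
rank-one cells `B = β`, `δ = β⁻¹ a`, `γ = a' β'⁻¹`). [cite: Weil1964, n° 15 Thm. 3, p. 163; Rangarao1993, Thm. 4.1 (4), p. 358] -/
theorem rankOne_scalar_cocycle [MeasurableSpace (v.adicCompletion F)] [BorelSpace (v.adicCompletion F)]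
    (μ : Measure (v.adicCompletion F)) [μ.IsAddHaarMeasure] (m : ℤ) (hm : (adeleAddCharAt F v).HasConductorExp m)
    (z z' : localPi E c 1 J₁ v) (a b a' b' : v.adicCompletion F)
    (ha : a = QuadraticCoordinates.re (quadraticLocalEquiv E v c hcδ hδ).toLinearEquiv.toAddEquiv
      (fun w : PlacesOver E v => ((z : LocalGLPi E 1 v) w).val 0 0))
    (hb : b = QuadraticCoordinates.im (quadraticLocalEquiv E v c hcδ hδ).toLinearEquiv.toAddEquiv
      (fun w : PlacesOver E v => ((z : LocalGLPi E 1 v) w).val 0 0))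
    (ha' : a' = QuadraticCoordinates.re (quadraticLocalEquiv E v c hcδ hδ).toLinearEquiv.toAddEquiv
      (fun w : PlacesOver E v => ((z' : LocalGLPi E 1 v) w).val 0 0))
    (hb' : b' = QuadraticCoordinates.im (quadraticLocalEquiv E v c hcδ hδ).toLinearEquiv.toAddEquiv
      (fun w : PlacesOver E v => ((z' : LocalGLPi E 1 v) w).val 0 0))
    (hβ : (d : v.adicCompletion F) * b * (localGram F 1 t v 0 0)⁻¹ ≠ 0)
    (hβ' : (d : v.adicCompletion F) * b' * (localGram F 1 t v 0 0)⁻¹ ≠ 0)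
    (hβ'' : (d : v.adicCompletion F) * (a * b' + b * a') * (localGram F 1 t v 0 0)⁻¹ ≠ 0)
    (lam lam' lam'' : ℂ)
    (hlam : ∀ f : SchwartzBruhat (Fin 1 → v.adicCompletion F), ((MpPsi.toRep (localSchrodinger F 1 t v)).comp s₁) z f =
      lam • bigCellOp (isLocallyConstant_of_isContinuousNontrivial (isContinuousNontrivial_adeleAddCharAt F v))
        μ (isContinuousNontrivial_adeleAddCharAt F v) hm
        (symplecticConj (gramProd (localGram F 1 t v) (UnitaryGroup.isUnit_det_map (algebraMap F (v.adicCompletion F)) htd))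
          (polar_dotProductBilin_gramProd (localGram F 1 t v) (UnitaryGroup.isUnit_det_map (algebraMap F (v.adicCompletion F)) htd))
          (iota F E c 1 hcδ hδ hd t ht hJ₁ v z)) f)
    (hlam' : ∀ f : SchwartzBruhat (Fin 1 → v.adicCompletion F), ((MpPsi.toRep (localSchrodinger F 1 t v)).comp s₁) z' f =
      lam' • bigCellOp (isLocallyConstant_of_isContinuousNontrivial (isContinuousNontrivial_adeleAddCharAt F v))
        μ (isContinuousNontrivial_adeleAddCharAt F v) hm
        (symplecticConj (gramProd (localGram F 1 t v) (UnitaryGroup.isUnit_det_map (algebraMap F (v.adicCompletion F)) htd))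
          (polar_dotProductBilin_gramProd (localGram F 1 t v) (UnitaryGroup.isUnit_det_map (algebraMap F (v.adicCompletion F)) htd))
          (iota F E c 1 hcδ hδ hd t ht hJ₁ v z')) f)
    (hlam'' : ∀ f : SchwartzBruhat (Fin 1 → v.adicCompletion F),
      ((MpPsi.toRep (localSchrodinger F 1 t v)).comp s₁) (z * z') f =
      lam'' • bigCellOp (isLocallyConstant_of_isContinuousNontrivial (isContinuousNontrivial_adeleAddCharAt F v))
        μ (isContinuousNontrivial_adeleAddCharAt F v) hm
        (symplecticConj (gramProd (localGram F 1 t v) (UnitaryGroup.isUnit_det_map (algebraMap F (v.adicCompletion F)) htd))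
          (polar_dotProductBilin_gramProd (localGram F 1 t v) (UnitaryGroup.isUnit_det_map (algebraMap F (v.adicCompletion F)) htd))
          (iota F E c 1 hcδ hδ hd t ht hJ₁ v (z * z'))) f) :
    lam * lam' *
        (weilGauss (adeleAddCharAt F v) μ
            (-(⅟(2 : v.adicCompletion F) *
              (((d : v.adicCompletion F) * b' * (localGram F 1 t v 0 0)⁻¹) *
                ((((d : v.adicCompletion F) * b * (localGram F 1 t v 0 0)⁻¹)⁻¹ * a +
                    a' * ((d : v.adicCompletion F) * b' * (localGram F 1 t v 0 0)⁻¹)⁻¹) *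
                  ((d : v.adicCompletion F) * b' * (localGram F 1 t v 0 0)⁻¹))))) *
          (Real.sqrt (normAbs (v.adicCompletion F)
            (((d : v.adicCompletion F) * b' * (localGram F 1 t v 0 0)⁻¹) *
              ((((d : v.adicCompletion F) * b * (localGram F 1 t v 0 0)⁻¹)⁻¹ * a +
                  a' * ((d : v.adicCompletion F) * b' * (localGram F 1 t v 0 0)⁻¹)⁻¹) *
                ((d : v.adicCompletion F) * b' * (localGram F 1 t v 0 0)⁻¹)))) : ℂ)) = lam'' := by
  classical
  -- ### notation
  have hψ := isContinuousNontrivial_adeleAddCharAt F v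
  have hq := isQuadraticCoordinates_local E v c hcδ hδ hd
  set τ : (v.adicCompletion F) := localGram F 1 t v 0 0 with hτ
  set β : (v.adicCompletion F) := (d : (v.adicCompletion F)) * b * τ⁻¹ with hβdef
  set β' : (v.adicCompletion F) := (d : (v.adicCompletion F)) * b' * τ⁻¹ with hβ'def
  set eeq := gramProd (localGram F 1 t v) (UnitaryGroup.isUnit_det_map (algebraMap F (v.adicCompletion F)) htd) with heeq
  set hBe := polar_dotProductBilin_gramProd (localGram F 1 t v) (UnitaryGroup.isUnit_det_map (algebraMap F (v.adicCompletion F)) htd)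
  set g₁ := symplecticConj eeq hBe (iota F E c 1 hcδ hδ hd t ht hJ₁ v z) with hg₁
  set g₂ := symplecticConj eeq hBe (iota F E c 1 hcδ hδ hd t ht hJ₁ v z') with hg₂
  have hg₁₂ : symplecticConj eeq hBe (iota F E c 1 hcδ hδ hd t ht hJ₁ v (z * z')) = g₁ * g₂ := by
    rw [map_mul, map_mul]
  -- coordinates of `z z'`
  have hsc := rankOne_scalar_mul E c J₁ v z z'
  have ha'' : QuadraticCoordinates.re (quadraticLocalEquiv E v c hcδ hδ).toLinearEquiv.toAddEquiv
      (fun w : PlacesOver E v => (((z * z' : localPi E c 1 J₁ v) : LocalGLPi E 1 v) w).val 0 0) =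
      a * a' + (d : (v.adicCompletion F)) * (b * b') := by
    rw [hsc, hq.re_mul, ← ha, ← hb, ← ha', ← hb']
  have hb''eq : QuadraticCoordinates.im (quadraticLocalEquiv E v c hcδ hδ).toLinearEquiv.toAddEquiv
      (fun w : PlacesOver E v => (((z * z' : localPi E c 1 J₁ v) : LocalGLPi E 1 v) w).val 0 0) =
      a * b' + b * a' := by
    rw [hsc, hq.im_mul, ← ha, ← hb, ← ha', ← hb']
  -- the `B`-blocks are invertible
  have hB₁ := rankOne_blockB_bijective E c hcδ hδ hd t ht htd hJ₁ v z g₁ hg₁ (by rw [← hb]; exact hβ)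
  have hB₂ := rankOne_blockB_bijective E c hcδ hδ hd t ht htd hJ₁ v z' g₂ hg₂ (by rw [← hb']; exact hβ')
  -- the cells (pointwise)
  have hc₁ := fun x => rankOne_cells E c hcδ hδ hd t ht htd hJ₁ v z g₁ hg₁ (by rw [← hb]; exact hβ) hB₁ x
  have hc₂ := fun x => rankOne_cells E c hcδ hδ hd t ht htd hJ₁ v z' g₂ hg₂ (by rw [← hb']; exact hβ') hB₂ x
  simp only [← ha, ← hb] at hc₁
  simp only [← ha', ← hb'] at hc₂
  -- ### Weil's `T = ᵗB₂ (δ₁ + γ₂) B₂` is the homothety `T`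
  set T : (v.adicCompletion F) := β' * ((β⁻¹ * a + a' * β'⁻¹) * β') with hTdef
  have hd0 : (d : (v.adicCompletion F)) ≠ 0 := (mul_ne_zero_iff.1 (mul_ne_zero_iff.1 hβ).1).1
  have hb0 : b ≠ 0 := (mul_ne_zero_iff.1 (mul_ne_zero_iff.1 hβ).1).2
  have hb'0 : b' ≠ 0 := (mul_ne_zero_iff.1 (mul_ne_zero_iff.1 hβ').1).2
  have hτ0 : τ ≠ 0 := fun h => (mul_ne_zero_iff.1 hβ).2 (by rw [h, _root_.inv_zero])
  have hT0 : T ≠ 0 := by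
    have e : T = β⁻¹ * ((d : (v.adicCompletion F)) * (a * b' + b * a') * τ⁻¹) * β' := by
      rw [hTdef, hβdef, hβ'def]; field_simp
    rw [e]; exact mul_ne_zero (mul_ne_zero (inv_ne_zero hβ) hβ'') hβ'
  set Tₑ : (Fin 1 → (v.adicCompletion F)) ≃ₗ[(v.adicCompletion F)] (Fin 1 → (v.adicCompletion F)) := LinearEquiv.smulOfNeZero (v.adicCompletion F) (Fin 1 → (v.adicCompletion F)) T hT0 with hTₑ
  have htrans : ∀ x : Fin 1 → (v.adicCompletion F), transposePi (cellB _ hB₂) x = β' • x := by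
    intro x
    refine dotProduct_eq _ _ fun u => ?_  -- characterise by the pairing
    have h := dotProductBilin_transposePi (cellB _ hB₂) u x
    rw [dotProductBilin_apply_apply, dotProductBilin_apply_apply] at h
    have hBx : (cellB _ hB₂ : (Fin 1 → (v.adicCompletion F)) ≃ₗ[(v.adicCompletion F)] (Fin 1 → (v.adicCompletion F))) u = β' • u := by
      have h1 := (hc₂ (β' • u)).1
      rw [smul_smul, inv_mul_cancel₀ hβ', one_smul] at h1
      have h2 := congrArg (cellB _ hB₂) h1
      rw [LinearEquiv.apply_symm_apply] at h2
      exact h2.symm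
    rw [dotProduct_comm, h, hBx, smul_dotProduct, smul_dotProduct, dotProduct_comm]
  have hTe : (Tₑ : (Fin 1 → (v.adicCompletion F)) →ₗ[(v.adicCompletion F)] (Fin 1 → (v.adicCompletion F))) =
      ((transposePi (cellB _ hB₂) : (Fin 1 → (v.adicCompletion F)) ≃ₗ[(v.adicCompletion F)] (Fin 1 → (v.adicCompletion F))) : (Fin 1 → (v.adicCompletion F)) →ₗ[(v.adicCompletion F)] (Fin 1 → (v.adicCompletion F))) ∘ₗ
        (cellDelta _ hB₁ + cellGamma _ hB₂) ∘ₗ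
        ((cellB _ hB₂ : (Fin 1 → (v.adicCompletion F)) ≃ₗ[(v.adicCompletion F)] (Fin 1 → (v.adicCompletion F))) : (Fin 1 → (v.adicCompletion F)) →ₗ[(v.adicCompletion F)] (Fin 1 → (v.adicCompletion F))) := by
    apply LinearMap.ext; intro x
    have hBx : (cellB _ hB₂ : (Fin 1 → (v.adicCompletion F)) ≃ₗ[(v.adicCompletion F)] (Fin 1 → (v.adicCompletion F))) x = β' • x := by
      have h1 := (hc₂ (β' • x)).1
      rw [smul_smul, inv_mul_cancel₀ hβ', one_smul] at h1
      have h2 := congrArg (cellB _ hB₂) h1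
      rw [LinearEquiv.apply_symm_apply] at h2
      exact h2.symm
    rw [LinearEquiv.coe_coe, hTₑ, LinearEquiv.smulOfNeZero_apply, LinearMap.comp_apply, LinearMap.comp_apply,
      LinearEquiv.coe_coe, LinearEquiv.coe_coe, hBx, LinearMap.add_apply, map_smul, map_smul, (hc₁ x).2.2, (hc₂ x).2.1,
      htrans, hTdef]
    simp only [smul_smul]
    module
  -- ### Weil's multiplication formula for `r(g₁) r(g₂)`
  have hw₁ := eq_canonicalWord g₁ hB₁
  have hw₂ := eq_canonicalWord g₂ hB₂
  have hweil := bigCellOp_mul_bigCellOp (isLocallyConstant_of_isContinuousNontrivial hψ) μ hψ hm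
    (cellGamma _ hB₁) (cellDelta _ hB₁) (cellGamma _ hB₂) (cellDelta _ hB₂)
    (cellGamma_symm g₁ hB₁) (cellDelta_symm g₁ hB₁) (cellGamma_symm g₂ hB₂) (cellDelta_symm g₂ hB₂)
    (cellB _ hB₁) (cellB _ hB₂) Tₑ hTe
  rw [← hw₁, ← hw₂] at hweil
  -- ### compare `ω(z) ω(z') = ω(z z')` on a test vector
  have hprod : ∀ f : SchwartzBruhat (Fin 1 → (v.adicCompletion F)),
      ((MpPsi.toRep (localSchrodinger F 1 t v)).comp s₁) (z * z') f =
        (lam * lam' * weilKappa μ (ψ := adeleAddCharAt F v) Tₑ) •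
          bigCellOp (isLocallyConstant_of_isContinuousNontrivial hψ) μ hψ hm (g₁ * g₂) f := by
    intro f
    rw [map_mul, Module.End.mul_apply, hlam', map_smul, hlam, smul_smul, ← LinearEquiv.mul_apply, hweil,
      LinearEquiv.mul_apply, scalarOp_apply, Units.val_mk0, smul_smul]
    ring_nf
  have hf0 : bigCellOp (isLocallyConstant_of_isContinuousNontrivial hψ) μ hψ hm (g₁ * g₂) (piBallSB (v.adicCompletion F) (Fin 1) 0) ≠ 0 := by
    intro h0
    have h1 : (piBallSB (v.adicCompletion F) (Fin 1) 0 : SchwartzBruhat (Fin 1 → (v.adicCompletion F))) = 0 :=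
      (bigCellOp (isLocallyConstant_of_isContinuousNontrivial hψ) μ hψ hm (g₁ * g₂)).injective (by rw [h0, map_zero])
    have h2 := congrArg (fun f : SchwartzBruhat (Fin 1 → (v.adicCompletion F)) => (f : (Fin 1 → (v.adicCompletion F)) → ℂ) 0) h1
    simp only [coe_piBallSB, Submodule.coe_zero, Pi.zero_apply, Set.indicator_of_mem (zero_mem_piPrimePowBall _)] at h2
    exact one_ne_zero h2
  have key := hprod (piBallSB (v.adicCompletion F) (Fin 1) 0)
  rw [hlam'' (piBallSB (v.adicCompletion F) (Fin 1) 0), hg₁₂] at key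
  have hcoef := smul_left_injective ℂ hf0 key
  -- `κ(Tₑ) = g(-T/2) √‖T‖`
  rw [weilKappa_smulOfNeZero μ hψ hT0] at hcoef
  rw [hcoef]

end Cocycle

end Literature.RepresentationTheory.MoeglinVignerasWaldspurger1987

end
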